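import Summits.Ventures.QEC.Census.CertCoverProducers
import Summits.Ventures.QEC.Census.BB.BB288.CoverAuts
import HarnessLib

set_option Elab.async false

/-!
# `[[288,12,18]]` cover certificate — the automorphism TABLE hypotheses `hauts1` / `hauts2` of T1 / T2 (qec lane ε,
# type-10 side; TEMPLATE §0)

From search-9's 72 per-translation facts `aut<i>_ok` (CoverAutsA–F: `permCompatOK` for both cover steps and the FAST
lockstep row maps `rowMapOKL` of BZAutPermFast — nothing decided at `288²`) and the table lists of `CoverAuts`, the
Bool hypotheses `autsCompatOK` / `autsCompat2OK` of `CertCoverAssembly.flat_of_cover'` / `cov_of_levels` via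
`CertCoverProducers.autsCompat[2]OK_of_forallL`.  HONEST FRAMING: per-code glue; everything proved; tier KERNEL,
axioms standard.
-/

namespace Summit.Ventures.QEC.Census.BB288Cover

open Summit.Ventures.QEC.Census

/-- The table lists have 72 entries each. -/
theorem auts_lengths : perms.length = 72 ∧ permqs.length = 72 ∧ permqqs.length = 72 ∧ rowss.length = 72 := by
  refine ⟨?_, ?_, ?_, ?_⟩ <;> decide

/-- Per-index facts, read off the 72 named theorems `aut<i>_ok`. -/
theorem auts_forall : ∀ i : ℕ, i < perms.length →
    cov1.permCompatOK (perms.getD i []) (permqs.getD i []) = true ∧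
      cov2.permCompatOK (permqs.getD i []) (permqqs.getD i []) = true ∧
      rowMapOKL bb288HX (perms.getD i []) (rowss.getD i []) = true ∧
      rowMapOKL bb288HZ (perms.getD i []) (rowss.getD i []) = true := by
  intro i hi
  have hi' : i < 72 := lt_of_lt_of_eq hi auts_lengths.1
  interval_cases i
  · exact aut0_ok
  · exact aut1_ok
  · exact aut2_ok
  · exact aut3_ok
  · exact aut4_ok
  · exact aut5_ok
  · exact aut6_ok
  · exact aut7_ok
  · exact aut8_ok
  · exact aut9_ok
  · exact aut10_ok
  · exact aut11_ok
  · exact aut12_ok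
  · exact aut13_ok
  · exact aut14_ok
  · exact aut15_ok
  · exact aut16_ok
  · exact aut17_ok
  · exact aut18_ok
  · exact aut19_ok
  · exact aut20_ok
  · exact aut21_ok
  · exact aut22_ok
  · exact aut23_ok
  · exact aut24_ok
  · exact aut25_ok
  · exact aut26_ok
  · exact aut27_ok
  · exact aut28_ok
  · exact aut29_ok
  · exact aut30_ok
  · exact aut31_ok
  · exact aut32_ok
  · exact aut33_ok
  · exact aut34_ok
  · exact aut35_ok
  · exact aut36_ok
  · exact aut37_ok
  · exact aut38_ok
  · exact aut39_ok
  · exact aut40_ok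
  · exact aut41_ok
  · exact aut42_ok
  · exact aut43_ok
  · exact aut44_ok
  · exact aut45_ok
  · exact aut46_ok
  · exact aut47_ok
  · exact aut48_ok
  · exact aut49_ok
  · exact aut50_ok
  · exact aut51_ok
  · exact aut52_ok
  · exact aut53_ok
  · exact aut54_ok
  · exact aut55_ok
  · exact aut56_ok
  · exact aut57_ok
  · exact aut58_ok
  · exact aut59_ok
  · exact aut60_ok
  · exact aut61_ok
  · exact aut62_ok
  · exact aut63_ok
  · exact aut64_ok
  · exact aut65_ok
  · exact aut66_ok
  · exact aut67_ok
  · exact aut68_ok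
  · exact aut69_ok
  · exact aut70_ok
  · exact aut71_ok

/-- **`hauts2`** of T2 (`cov_of_levels`): the two-step automorphism tables pass. -/
theorem hauts2 : autsCompat2OK cov1 cov2 bb288HX bb288HZ perms permqs permqqs rowss rowss = true :=
  autsCompat2OK_of_forallL (auts_lengths.2.1.trans auts_lengths.1.symm)
    (auts_lengths.2.2.1.trans auts_lengths.1.symm) auts_forall

/-- **`hauts1`** of T1 (`flat_of_cover'`): the one-step automorphism tables pass. -/
theorem hauts1 : autsCompatOK cov1 bb288HX bb288HZ perms permqs rowss rowss = true :=
  autsCompatOK_of_forallL (auts_lengths.2.1.trans auts_lengths.1.symm) fun i hi =>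
    ⟨(auts_forall i hi).1, (auts_forall i hi).2.2.1, (auts_forall i hi).2.2.2⟩

end Summit.Ventures.QEC.Census.BB288Cover
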